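import Summits.ValiantsHypothesis.ValiantsHypothesis.Theorems.TwoAdicLadderPrecisionLadderLadderZCalibration
import Literature.Computability.AlgebraicComplexity.ArithCircuitVarsCount
import Literature.Computability.AlgebraicComplexity.PermanentIrreducible

/-!
# TwoAdicLadder — crux `PrecisionLadder` (stmt-ValiantsHypothesis-5948), line `birth`,
# registered stub `stub_ladderZ`: THE TRIVIAL RUNGS `c ≤ 1`, AND WHERE THE REAL LADDER STARTS

The registered open stub of `Cruxes/PrecisionLadder/Lines/birth.lean` is a ladder of rungs indexed
by the exponent `c`:

  `rung c :  ∃ᶠ n in atTop, ∃ k, n ^ c < complexity (perPoly (Fin n) (ZMod (2 ^ (k + 1))))`,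

`stub_ladderZ = ∀ c, rung c`.  In the tree's model (`complexity` = least number of gates of a
FAN-IN-TWO circuit, Bürgisser's `L` up to a factor `≤ 3`) a circuit computing a polynomial in which
`N` variables occur has at least `(N - 1)/2` gates (tree `card_vars_le_complexity`:
`#vars(f) ≤ 2·L(f) + 1`), and all `n²` variables occur in `per_n` over any non-trivial ring
(tree `degreeOf_perPoly`).  Hence:

* `sq_le_two_mul_complexity_perPoly_succ` — `n² ≤ 2·L_R(per_n) + 1` over every non-trivial
  commutative semiring `R`; `lt_complexity_perPoly_zmod` — `n < L_{ℤ/2^(k+1)}(per_n)` for all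
  `n ≥ 3` and EVERY precision `k` (already `k = 0`, i.e. over `𝔽₂`, where `per = det`);
* `ladderZ_rung_of_le_one` — **rungs `c = 0` and `c = 1` of the stub hold** (input counting; they
  hold at every precision, so they carry no `2`-adic information).

Honest framing (rung currency): these two rungs are TRIVIAL (variable counting) and are recorded only
to fix where the ladder's content begins.  Rung `c = 2` (`L > n² = N`) is within a constant of the
same counting bound and is not pursued; rung `c = 3` (`L_{ℤ/2^(k+1)}(per_n) > n³ = N^{3/2}` for
infinitely many `n`, some `k`) would be a SUPER-LINEAR lower bound for an explicit polynomial
against general fan-in-two arithmetic circuits over a fixed finite ring — beyond every known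
technique (Baur–Strassen's `Ω(N log d)` is the record over fields and does not reach `N^{1+ε}`);
by `…LadderZTwoAdic.lean` the full stub is `per ∉ VP_{ℤ₂}`.  Nothing here is progress on
`stub_ladderZ` beyond `c ≤ 1`, on the crux, or on `VP ≠ VNP`, which are NOT proved.  No new
definitions, no named facts, no sorry.

## References

* P. Bürgisser, *Completeness and Reduction in Algebraic Complexity Theory* (2000), Def. 2.1
  (the measure `L`), Rem. 2.2. [cite: Burgisser2000, Def. 2.1]
* W. Baur, V. Strassen, *The complexity of partial derivatives*, TCS 22 (1983) 317–330 (the only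
  general super-linear lower bound `Ω(N log d)`). [cite: BaurStrassen1983, Thm. 3]
-/

noncomputable section

open MvPolynomial

-- the summit and the problem share the name `ValiantsHypothesis` (D-0017 single-conjunct layout)
set_option linter.dupNamespace false

namespace Summit.ValiantsHypothesis.ValiantsHypothesis.Theorems.TwoAdicLadderPrecisionLadder

open Filter Literature.Computability.AlgebraicComplexity

/-- **Input counting.** Over a non-trivial commutative semiring all `n²` variables occur in `per_n`
(`degreeOf_perPoly`), and a fan-in-two circuit of size `L` mentions at most `2L + 1` variables
(`card_vars_le_complexity`); so `n² ≤ 2·L_R(per_n) + 1`. [cite: Burgisser2000, Def. 2.1] -/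
theorem sq_le_two_mul_complexity_perPoly_succ (R : Type) [CommSemiring R] [Nontrivial R] (n : ℕ) :
    n * n ≤ 2 * complexity (perPoly (Fin n) R) + 1 := by
  classical
  have hvars : (perPoly (Fin n) R).vars = Finset.univ := by
    ext v
    simp only [Finset.mem_univ, iff_true]
    rw [mem_vars_iff_degreeOf_ne_zero, degreeOf_perPoly R v]
    exact one_ne_zero
  have h := card_vars_le_complexity (perPoly (Fin n) R)
  rwa [hvars, Finset.card_univ, Fintype.card_prod, Fintype.card_fin] at h

/-- **`n < L_{ℤ/2^(k+1)}(per_n)` for every `n ≥ 3` and every precision `k`** (from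
`n² ≤ 2L + 1`: `2L ≥ n² - 1 ≥ 2n + 2`). In particular already over `𝔽₂ = ℤ/2` (`k = 0`), where
`per_n = det_n`: the bound carries no `2`-adic information. [cite: Burgisser2000, Def. 2.1] -/
theorem lt_complexity_perPoly_zmod {n : ℕ} (hn : 3 ≤ n) (k : ℕ) :
    n < complexity (perPoly (Fin n) (ZMod (2 ^ (k + 1)))) := by
  haveI : Fact (1 < 2 ^ (k + 1)) := ⟨Nat.one_lt_two_pow (Nat.succ_ne_zero k)⟩
  have h := sq_le_two_mul_complexity_perPoly_succ (ZMod (2 ^ (k + 1))) n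
  nlinarith

/-- **Rungs `c = 0` and `c = 1` of `stub_ladderZ` (trivial, by input counting).** For `c ≤ 1`:
`∃ᶠ n, ∃ k, n ^ c < L_{ℤ/2^(k+1)}(per_n)` — in fact for ALL `n ≥ 3` and with ANY `k` (here
`k = 0`). Honest label: variable counting only; the first rung with content is `c = 3`
(super-linear), which is open. [cite: Burgisser2000, Def. 2.1] -/
theorem ladderZ_rung_of_le_one {c : ℕ} (hc : c ≤ 1) :
    ∃ᶠ n in atTop, ∃ k : ℕ, n ^ c < complexity (perPoly (Fin n) (ZMod (2 ^ (k + 1)))) := by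
  refine Filter.Eventually.frequently ?_
  filter_upwards [eventually_ge_atTop 3] with n hn
  refine ⟨0, lt_of_le_of_lt ?_ (lt_complexity_perPoly_zmod hn 0)⟩
  calc n ^ c ≤ n ^ 1 := Nat.pow_le_pow_right (by omega) hc
    _ = n := pow_one n

end Summit.ValiantsHypothesis.ValiantsHypothesis.Theorems.TwoAdicLadderPrecisionLadder

end
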